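import Mathlib
import HarnessLib
import Literature.Geometry.DiscreteGeometry.TwoShellPatterns
import Literature.MathematicalPhysics.StatisticalMechanics.Crystallization
import Literature.Probability.Process.PointStationaryLaw
import Literature.MathematicalPhysics.StatisticalMechanics.RootEnergy

/-!
# Sketch — crux-ideate round 1, ideator 2, crux `PhononSlackCertificates.FarFieldGapR`
(item stmt-AtomisticToContinuum-14969).

First lemmas of the two crux idea cards
`Ideas/octahedral-poisoning-collapse.md` (§A) and `Ideas/minimising-laws-somewhere-good.md` (§C),
plus the folklore "canonical elastic transfer" identity used in the numerics note (§B, PROVED).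
Every other `theorem` is a SIGNATURE that must elaborate (proof `sorry`); the two compositions
`farFieldGapR_of_allBadGap` and `farFieldGapR_of_minimisingLaws` are real proofs from the sorried
signatures and conclude the crux decl BY NAME.
-/

noncomputable section

open scoped BigOperators
open Filter Set Function MeasureTheory

namespace Summit.AtomisticToContinuum.Crystallization.Cruxes.FarFieldGapR.IdeatorTwo

open Literature.MathematicalPhysics.StatisticalMechanics
open Literature.Geometry.DiscreteGeometry
open Literature.Probability.Process

local notation "E³" => EuclideanSpace ℝ (Fin 3)

/-- VERBATIM COPY of the route decl `PhononSlackCertificates.FarFieldGapR` (rev 4, item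
stmt-AtomisticToContinuum-14969): the farm's snapshot of the Theses file predates rev 4, so the
name does not resolve there yet (same caveat as the refuter's W2.lean); replace `FarFieldGapR'`
by `FarFieldGapR` once it syncs — the two are syntactically identical. -/
def FarFieldGapR' : Prop :=
  ∀ δ : ℝ, 0 < δ → ∃ g : ℝ, 0 < g ∧ ∃ C R : ℝ, ∀ (N : ℕ) (x : Fin N → EuclideanSpace ℝ (Fin 3)), (∀ i j : Fin N, i ≠ j → δ ≤ dist (x i) (x j)) → ∀ U : Finset (Fin N), (∀ i ∈ U, ¬ Literature.Geometry.DiscreteGeometry.IsTwoShellGood (1 / 20) (47 / 50) 1 x i) → g * (U.card : ℝ) - C * (Nat.card {i : Fin N // i ∈ U ∧ ∃ j : Fin N, j ∉ U ∧ dist (x j) (x i) ≤ R} : ℝ) ≤ ∑ i ∈ U, ((1 / 2 : ℝ) * (∑ j ∈ Finset.univ.erase i, Literature.MathematicalPhysics.StatisticalMechanics.lennardJones (dist (x i) (x j))) - (⨅ Q : Literature.MathematicalPhysics.StatisticalMechanics.PeriodicConfiguration 3, Q.energyPerParticle Literature.MathematicalPhysics.StatisticalMechanics.lennardJones))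

/-- VERBATIM COPY of the route decl `PhononSlackCertificates.AllBadGap` (support item
stmt-AtomisticToContinuum-13960), inlined so that this file does not import the Theses module
(incoherent on the farm at session time); syntactically identical to the route decl. -/
def AllBadGap' : Prop :=
  ∀ δ : ℝ, 0 < δ → ∃ g : ℝ, 0 < g ∧ ∀ (N : ℕ) (x : Fin N → EuclideanSpace ℝ (Fin 3)), (∀ i j : Fin N, i ≠ j → δ ≤ dist (x i) (x j)) → (∀ i : Fin N, ¬ Literature.Geometry.DiscreteGeometry.IsTwoShellGood (1 / 20) (47 / 50) 1 x i) → (N : ℝ) * ((⨅ Q : Literature.MathematicalPhysics.StatisticalMechanics.PeriodicConfiguration 3, Q.energyPerParticle Literature.MathematicalPhysics.StatisticalMechanics.lennardJones) + g) ≤ Literature.MathematicalPhysics.StatisticalMechanics.interactionEnergy Literature.MathematicalPhysics.StatisticalMechanics.lennardJones x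

/-- `e* = ⨅` over periodic configurations of the Lennard-Jones energy per particle. -/
def eStar : ℝ :=
  ⨅ Q : PeriodicConfiguration 3, Q.energyPerParticle lennardJones

/-- number of 1/20-GOOD particles of a finite configuration (the route's predicate). -/
def goodCount {N : ℕ} (y : Fin N → E³) : ℕ :=
  Nat.card {i : Fin N // IsTwoShellGood (1 / 20) (47 / 50) 1 y i}

/-! ## §A  Octahedral poisoning: `AllBadGap → FarFieldGapR` (card octahedral-poisoning-collapse) -/

/-- (A0) GOOD-ALLOWANCE FORM of the far field — no set `U`, no radius `R`, no site energies:
`E(y) ≥ |y|·(e* + g) − C·#good(y)` on `δ`-separated configurations. -/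
def GoodAllowanceGap : Prop :=
  ∀ δ : ℝ, 0 < δ → ∃ g : ℝ, 0 < g ∧ ∃ C : ℝ, ∀ (N : ℕ) (y : Fin N → E³),
    (∀ i j : Fin N, i ≠ j → δ ≤ dist (y i) (y j)) →
      (N : ℝ) * (eStar + g) - C * (goodCount y : ℝ) ≤ interactionEnergy lennardJones y

/-- (A1) OCTAHEDRAL POISONING LEMMA (finite geometry, explicit constants): inserting one particle
at the octahedral hole adjacent to a good particle makes every particle within `3a/2` of the hole
bad (pattern sites are `≥ a ≥ 47/50` apart while the hole has six particles within `0.76`, so no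
fit can match the intruder), creates no good particle elsewhere (goodness is decided within radius
`≤ 1.55`), keeps separation `≥ min δ (3/5)` and costs `≤ K(δ)` in energy (six hole-neighbours at `≥ 0.618`
contribute `≤ 6·V(0.618) ≈ 144`; the only `δ`-dependence is the number of outsiders in the shell
`0.745 ≤ r < 1` around the intruder, each `≤ V(0.745) < 2`); iterate over the good particles. -/
theorem poisoning {δ : ℝ} (hδ : 0 < δ) :
    ∃ K : ℝ, ∀ {N : ℕ} (y : Fin N → E³), (∀ i j : Fin N, i ≠ j → δ ≤ dist (y i) (y j)) →
      ∃ (M : ℕ) (y' : Fin M → E³) (ι : Fin N ↪ Fin M),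
        (∀ i : Fin N, y' (ι i) = y i) ∧
        (M : ℝ) ≤ N + goodCount y ∧
        (∀ i j : Fin M, i ≠ j → min δ (3 / 5) ≤ dist (y' i) (y' j)) ∧
        (∀ i : Fin M, ¬ IsTwoShellGood (1 / 20) (47 / 50) 1 y' i) ∧
        interactionEnergy lennardJones y' ≤
          interactionEnergy lennardJones y + K * (goodCount y : ℝ) := by
  sorry

/-- (A2) poisoning turns the support item into the allowance form (`g ↦ g(min δ 3/5)`,
`C = K(min δ 3/5) + |e*|`). -/
theorem goodAllowanceGap_of_allBadGap : AllBadGap' → GoodAllowanceGap := by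
  sorry

/-- (A3) SUBCONFIGURATION STEP: apply the allowance form to `y := x|_U`; particles of `U` that
are good in `x|_U`, or interact with `Uᶜ` inside radius `R`, are `R`-boundary particles; the
attraction of arbitrary `δ`-separated matter beyond `R` is `≤ c·δ⁻³·(R − δ)⁻³` per site
(shell counting as in `sum_inv_pow_six_le`; the route header has `c = 2/3`), which fixes `R(δ)` with tail `≤ g/2` — the radius scales with `δ`, as
the refutation of `FarFieldGap` (p86053) demands. -/
theorem farFieldGapR_of_goodAllowanceGap : GoodAllowanceGap → FarFieldGapR' := by
  sorry

/-- (A) THE COLLAPSE: the rank-2 crux follows from its own `U = everything` special case.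
(The converse `FarFieldGapR → AllBadGap` is the refuter's checked `allBadGap_of_farFieldGapR`.) -/
theorem farFieldGapR_of_allBadGap (h : AllBadGap') : FarFieldGapR' :=
  farFieldGapR_of_goodAllowanceGap (goodAllowanceGap_of_allBadGap h)

/-- (A4) TORUS FORM: all-bad `δ`-separated PERIODIC configurations have energy per particle
`≥ e* + g(δ)` — no boundary at all. -/
def AllBadGapPeriodic : Prop :=
  ∀ δ : ℝ, 0 < δ → ∃ g : ℝ, 0 < g ∧ ∀ Q : PeriodicConfiguration 3,
    (∀ p ∈ Q.points, ∀ q ∈ Q.points, p ≠ q → δ ≤ dist p q) →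
    (∀ q ∈ Q.points, ¬ IsTwoShellGoodSet (1 / 20) (47 / 50) 1 Q.points q) →
      eStar + g ≤ Q.energyPerParticle lennardJones

/-- (A5) supercell periodisation (period `> diam + 4`: environments of radius `1.55` are
unchanged, cross terms `V < 0` beyond `1`): the torus form implies the finite support item. -/
theorem allBadGap_of_periodic : AllBadGapPeriodic → AllBadGap' := by
  sorry

/-- hence the torus form closes the crux. -/
theorem farFieldGapR_of_periodic (h : AllBadGapPeriodic) : FarFieldGapR' :=
  farFieldGapR_of_allBadGap (allBadGap_of_periodic h)

/-! ## §C  Measure level: minimising point-stationary laws are somewhere good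
(card minimising-laws-somewhere-good) -/

/-- (C0) STRICTLY GOOD ROOT of a rooted configuration `μ = count|S`: two-shell good at the
tighter tolerance `1/25` on the window `[47/50, 1]`, with the covering clause pushed out to
radius `3a/2 + 1/10` (so that the event is OPEN in the local topology on `δ`-separated rooted
configurations and its complement contains the closure of "root 1/20-bad"). -/
def StrictlyGoodRoot (μ : Measure E³) : Prop :=
  ∃ a : ℝ, 47 / 50 ≤ a ∧ a ≤ 1 ∧
    ∃ (A : E³ →ₗᵢ[ℝ] E³) (P : Finset E³) (f : E³ → E³),
      (P = fccTwoShellPattern ∨ P = hcpTwoShellPattern) ∧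
      (∀ v ∈ P, μ {f v} ≠ 0 ∧ dist (f v) (a • A v) ≤ a / 25) ∧ Set.InjOn f ↑P ∧
      ∀ y : E³, μ {y} ≠ 0 → y ≠ 0 → dist y 0 ≤ 3 / 2 * a + 1 / 10 → ∃ v ∈ P, f v = y

/-- (C1) THE QUALITATIVE STATEMENT `C⁺`: every point-stationary `δ`-hard-core law with mean root
energy `≤ e*` (a minimising law; `≥ e*` is `UnimodularEnergyLowerBound`, stmt-9229) charges the
event "the root is strictly good" — no constants, minimisers only. -/
def MinimisingLawsSomewhereGood : Prop :=
  ∀ δ : ℝ, 0 < δ → ∀ P : Measure (Measure E³), IsProbabilityMeasure P →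
    (∀ᵐ μ ∂P, IsRootedHardCore δ μ) → IsPointStationaryLaw P →
    (∫ μ, rootEnergy lennardJones μ ∂P) ≤ eStar →
      0 < P {μ | StrictlyGoodRoot μ}

/-- (C2) COMPACTNESS TRANSFER (the lever): if `AllBadGap` fails at `δ`, the uniformly-rooted
empirical laws of a violating sequence `y_n` (necessarily `|y_n| → ∞`, since `E(N)/N > e*` for
each fixed `N`) are exactly point-stationary, tight by the hard core, and converge along a
subsequence to a point-stationary `δ`-hard-core law with `∫ rootEnergy ≤ e*` (root energy is a
uniform limit of bounded-range continuous functionals, tail `≤ 250 δ⁻⁶ R⁻³`-type) whose root is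
a.s. in the closure of "1/20-bad", hence a.s. not strictly good — contradicting `C⁺`. -/
theorem allBadGap_of_minimisingLaws : MinimisingLawsSomewhereGood → AllBadGap' := by
  sorry

/-- (C) the measure-level statement closes the crux through §A. -/
theorem farFieldGapR_of_minimisingLaws (h : MinimisingLawsSomewhereGood) : FarFieldGapR' :=
  farFieldGapR_of_allBadGap (allBadGap_of_minimisingLaws h)

/-! ## §B  The canonical elastic transfer (folklore identity; PROVED)

At a force-balanced reference the linearised SITE energy is an exact antisymmetric pair transfer:
with pair coefficients `a i j` (think `½V'(r_ij)·r̂_ij`, so `a j i = −a i j`) balanced at `i`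
(`Σ_j a i j = 0`), the linear term `Σ_j ⟪a i j, u j − u i⟫` equals `Σ_j τ i j` with
`τ i j := ⟪a i j, u i + u j⟫`, and `τ` is antisymmetric. -/

theorem linearisation_eq_transfer {N : ℕ} (a : Fin N → Fin N → E³) (u : Fin N → E³) (i : Fin N)
    (hbal : ∑ j, a i j = 0) :
    ∑ j, inner ℝ (a i j) (u j - u i) = ∑ j, inner ℝ (a i j) (u i + u j) := by
  have h1 : ∑ j, inner ℝ (a i j) (u j - u i) = ∑ j, inner ℝ (a i j) (u j) - ∑ j, inner ℝ (a i j) (u i) := by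
    rw [← Finset.sum_sub_distrib]
    refine Finset.sum_congr rfl fun j _ => ?_
    rw [inner_sub_right]
  have h2 : ∑ j, inner ℝ (a i j) (u i + u j) = ∑ j, inner ℝ (a i j) (u i) + ∑ j, inner ℝ (a i j) (u j) := by
    rw [← Finset.sum_add_distrib]
    refine Finset.sum_congr rfl fun j _ => ?_
    rw [inner_add_right]
  have h3 : ∑ j, inner ℝ (a i j) (u i) = 0 := by
    rw [← sum_inner, hbal, inner_zero_left]
  rw [h1, h2, h3]
  ring

theorem transfer_antisymm {N : ℕ} (a : Fin N → Fin N → E³) (u : Fin N → E³)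
    (hanti : ∀ i j, a j i = -a i j) (i j : Fin N) :
    inner ℝ (a j i) (u j + u i) = -inner ℝ (a i j) (u i + u j) := by
  rw [hanti i j, inner_neg_left, add_comm (u j) (u i)]

end Summit.AtomisticToContinuum.Crystallization.Cruxes.FarFieldGapR.IdeatorTwo

end
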